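import Summits.NavierStokesRegularity.NavierStokesRegularity.Theorems.SwirlGaugedTower
import Summits.NavierStokesRegularity.NavierStokesRegularity.Theorems.SelfSimilarEtaBudget
import HarnessLib

/-!
# ROUND-17 (nsreg-p2, gen 19) — `MeridionalBarrier`: the ARRHENIUS LAW of the axis exponent

ROUND-15 located the inner exponential of the quantitative axisymmetric theory (Chen–Tsai–Zhang
arXiv:2201.01766 Prop. 1.2; Ożański–Palasek arXiv:2210.10030 §7): it is the Hölder exponent `γ`
of the swirl `Θ = r u^θ` at the axis, of the FORM `exp(-C·𝒩^θ)` in the critical drift gauge `𝒩`,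
and the funnel `q = (N/2)c(1-c²)` shows the form is sharp in the linear class (`γ ≈ √(N/π)e^{-N/4}`).
ROUND-16 asked that for Navier–Stokes the ARGUMENT be the swirl oscillation (`SwirlGaugedLaw`).
ROUND-17 identifies the argument in the linear class EXACTLY and splits ROUND-16's rung in two.

**The law (steady `(-1)`-homogeneous class, §1).**  With `c = cos ϑ`, profile `q` (`ρ u_ρ = -q'`,
`ρ sin ϑ u_ϑ = -q`), the separable swirl equation is the Sturm–Liouville problem
`(1-c²) e^{Φ} (e^{-Φ} G')' + (γ(γ-1) + γ q') G = 0`, `Φ' = q/(1-c²) = -ρ u_ϑ / sin ϑ`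
(`Φ` = the MERIDIONAL PÉCLET POTENTIAL: `dΦ = (-ρ u_ϑ) dϑ`, rising in the direction of POLEWARD
motion on spheres about the axis point).  The exponent is a KRAMERS LEAK RATE: backward
characteristics are trapped at a DIVERGENCE latitude `w` (meridional flow poleward on both sides)
and must climb `Φ` to reach a pole, where `Θ = 0` is absorbed.  Hence the conjectured two-sided law
`γ[q] = Pref[q] · exp(-B[q])`, `B[q]` = the TRAP DEPTH `sup_w min(rise of Φ from w to +1, rise of Φ
from w to -1)` (`ssTrapDepth`), `Pref` polynomial in the critical size (`ArrheniusLowerLaw`,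
`ArrheniusUpperLaw`).  `B` is SIGNED (only poleward motion costs) and ORDERED (a CONVERGENCE cell —
the reversed funnel — costs nothing).  Kit j276123 (T-17.2, Chebyshev collocation + companion
linearisation, FD cross-check): funnel `γ e^{B} ∈ [3.6, 5.1]` for `N = 8…72` (slope of `log γ` in
`B`: `-0.96`); reversed funnel `γ = 1.26, 1.11, 1.05, 1.02, 1.012, 1.006` at `N = 32…1024` and
Stokeslet stream `γ → 1.002` (`a = 512`), Landau (exact NS) `γ_A ↓ 1.03` — NO decay at `B = 0`
although the unsigned/unordered gauges (`sup ρ|u| = N`, cylindrical inflow `∫(u_r)₋/r ≈ 0.47N`,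
`min(∫Φ'₊, ∫Φ'₋) = N/4`) are as large as the funnel's; oblique and asymmetric divergence cells follow
`min` of the two rises (`γ e^{B} ∈ [0.14, 2.0]`); 180 random Chebyshev profiles (degree ≤ 8,
`sup ρ|u| ∈ [4, 70]`, `log γ ∈ [-17.6, 0.5]`): `log γ = -1.01·B - 0.24·log(1+N) + 0.69`,
`R² = 0.966`, rmse `0.63` — against `R² = 0.16` for `N` alone, `0.39` for the cylindrical inflow
Péclet, `0.39` for the unordered `min(∫Φ'₊, ∫Φ'₋)`.

**Dictionary with print's one-sided radial criteria.**  Pan (Acta Appl. Math. 150 (2017)) and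
Z. Zhang (JMAA 461 (2018)) prove regularity of axisymmetric Leray–Hopf solutions under
`r v_r ≥ -M` for `M < 2`; Q. S. Zhang (arXiv:2604.07785, 2026, Thm 1.1) under the partial Type-I
bound `v_r ≥ -c/√(T-t)` for every `c` — all by 1D COMPARISON for the modulus of `Γ` at the axis.
`M = 2` is not an artefact of comparison: it is the FELLER ACCESSIBILITY THRESHOLD of the pole under
line-sink inflow `r u_r ≡ -M` (`Φ = -M log sin ϑ`, scale function `∫ sin^{1-M} ϑ dϑ < ∞ ⇔ M < 2`);
inside the divergence-free finite-energy class a line sink must be cut off at an angle `ε` (the flux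
leaves as axial jets, scaled energy `E ∼ M²/ε²`), so `B = (M/2) log(1/ε²)` and the linear exponent
degenerates POLYNOMIALLY in the energy gauge, `γ ∼ (M²/E)^{(M-2)/2}` for `M > 2` (kit j276293,
T-17.4; `ssRadialInflow` is print's gauge).  For the funnel `B = M/2` exactly.

**The Navier–Stokes frame (§2).**  `meridionalPeclet ρ z₀ u` is the dimensionless, junk-free
(`∫⁻`) shell average of `min(northward, southward)` meridional Péclet about the axis point `z₀` —
an UNORDERED upper envelope of `π·B` on steady homogeneous flows (funnel: `π N/4`; it overcharges
convergence cells, never undercharges).  ROUND-16's rung factors through it: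
* `MeridionalGaugedHolderLaw γ₃` (LINEAR-TYPE, sharp by the funnel with `γ₃(P) ≍ e^{-P/π}`): at an
  axis point below which the meridional Péclet is `≤ P` at all scales, the swirl oscillation decays
  at rate `(r/ρ)^{γ₃ P}` with a POLYNOMIAL prefactor in the energy gauge `M`;
* `MeridionalSwirlLaw κ` (NAVIER–STOKES-ESSENTIAL; Bjerknes: poloidal circulation about material
  meridional loops is forced only by the swirl torque `∮ Γ²/r³ dr`; ROUND-16's η-budget gives
  `κ(S) ≲ 0.35·S` on steady funnels): below a polynomially small scale `(K(1+M)^K)^{-1}` the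
  meridional Péclet at an axis point is bounded by a function of the swirl oscillation ALONE;
* `swirlGaugedHolderLaw_of_meridional` (proved): the two together give ROUND-16's
  `SwirlGaugedHolderLaw (γ₃ ∘ κ)`, hence `SwirlGaugedLaw` and the polynomial Ożański–Palasek tower.
Why the prefactor must be polynomial and the threshold scale polynomial in `M`: anything worse puts
`M` back inside the exponential (print's shape) or re-doubles the tower (`r₀^{-12} = (pref·S/ε)^{12/γ}`).
T-17.1 (audit of CTZ22 §2, pp. 6–9): their Lemma 2.2 (mass lower bound by the flux identity) is
OUTFLOW-signed and every drift bound runs through `‖b‖_{L²} ≤ (RA)^{1/2}`, so a meridionally gauged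
law is NOT a corollary of the printed proof — it is a rung.

hard core evaded: all eight (0056, 10661, 16274, 15453, 1964, 0893, 0898, 1217) — §1 is ODE / real
analysis on a model class; §2 lives strictly below N0 (it presupposes the energy gauge `M < ∞`, under
which axisymmetric regularity is a theorem) and decides none of them.

This file: §1 (the steady homogeneous class).  §2 (the Navier–Stokes frame and the factorisation
of ROUND-16) is the sibling `…Theorems.MeridionalBarrierFrame` (split for the 400-line rule by the
landing seat nsreg-p4; planner nsreg-p2's companion `R17-MeridionalBarrier.lean`, sha16
f416b442f0c19a15, is otherwise verbatim).
Memo: `run/shared/lean/pub/ns-regularity-ideate/ns-regularity-ideate-p2/ROUND-17.md`.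
-/

namespace Summit.NavierStokesRegularity.NavierStokesRegularity.Theorems.MeridionalBarrier

open MeasureTheory Set Filter Topology Metric WithLp
open scoped ENNReal NNReal
open Literature.Analysis Literature.Analysis.FluidPDE
open Summit.NavierStokesRegularity.NavierStokesRegularity.Theorems.SwirlGaugedTower
  (TwoGaugeHolderLaw SwirlGaugedHolderLaw SwirlGaugedLaw)
open Summit.NavierStokesRegularity.NavierStokesRegularity.Theorems.SelfSimilarEtaBudget
  (IsPassiveExponent ssGroundExponent)

noncomputable section

/-! ## 1. The steady homogeneous class: meridional Péclet potential, trap depth, Arrhenius law -/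

/-- The MERIDIONAL PÉCLET POTENTIAL of the profile `q`: `Φ[q](c) = ∫₀ᶜ q(x)/(1-x²) dx`
(`dΦ = -ρ u_ϑ dϑ`: `Φ` increases in the direction of northward motion on the sphere; the
Sturm–Liouville weight of the separable swirl equation is `e^{-Φ}`). -/
def ssPotential (q : ℝ → ℝ) (c : ℝ) : ℝ :=
  ∫ x in (0 : ℝ)..c, q x / (1 - x ^ 2)

/-- Rise of the potential from latitude `w` toward the north pole `c = 1`
(the Péclet barrier a backward characteristic trapped at `w` must climb to be absorbed there). -/
def ssRiseNorth (q : ℝ → ℝ) (w : ℝ) : ℝ :=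
  sSup ((fun c => ssPotential q c - ssPotential q w) '' Icc w 1)

/-- Rise of the potential from latitude `w` toward the south pole `c = -1`. -/
def ssRiseSouth (q : ℝ → ℝ) (w : ℝ) : ℝ :=
  sSup ((fun c => ssPotential q c - ssPotential q w) '' Icc (-1) w)

/-- **TRAP DEPTH** `B[q] = sup_w min(rise to +1, rise to -1)`: positive iff some latitude band sends
fluid POLEWARD ON BOTH SIDES (a divergence cell); `= N/4` for the funnel `(N/2)c(1-c²)`, `= 0` for
the reversed funnel (a convergence cell), for one-way sweeps (Stokeslet stream `a(1-c²)`) and for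
the Landau solutions `2(1-c²)/(A-c)` (kit j276123). -/
def ssTrapDepth (q : ℝ → ℝ) : ℝ :=
  sSup ((fun w => min (ssRiseNorth q w) (ssRiseSouth q w)) '' Icc (-1) 1)

/-- The critical size of the profile, `sup ρ|u| = sup_c √(q'² + q²/(1-c²))` (print's gauge `𝒩`,
up to the choice of critical norm). -/
def ssSize (q : ℝ → ℝ) : ℝ :=
  sSup ((fun c => Real.sqrt (deriv q c ^ 2 + q c ^ 2 / (1 - c ^ 2))) '' Ioo (-1) 1)

/-- Print's ONE-SIDED RADIAL GAUGE `sup r (u_r)₋ = sup_c ((1-c²) q' + c q)₊` (Pan 2017,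
Z. Zhang 2018: regularity for `< 2`; funnel: `N/2 = 2·B`; Stokeslet stream: `0.385·a` with `B = 0`). -/
def ssRadialInflow (q : ℝ → ℝ) : ℝ :=
  sSup ((fun c => max ((1 - c ^ 2) * deriv q c + c * q c) 0) '' Icc (-1) 1)

/-- **ARRHENIUS LOWER LAW** (open; theorem-candidate by two-sided Kramers / Muckenhoupt bounds for
the Sturm–Liouville pencil, test T-17.3): every passive exponent is at least
`K⁻¹ (1 + size)^{-K} e^{-B[q]}`.  Kit j276123: `min γ e^{B} (1+N)^{0.24} ≈ 0.2` over 255 profiles. -/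
@[conjecture]
def ArrheniusLowerLaw : Prop :=
  ∃ K : ℝ, 0 < K ∧ ∀ q : ℝ → ℝ, ContDiff ℝ 3 q → q 1 = 0 → q (-1) = 0 →
    ∀ γ : ℝ, IsPassiveExponent q γ →
      K⁻¹ * (1 + ssSize q) ^ (-K) * Real.exp (-ssTrapDepth q) ≤ γ

/-- **ARRHENIUS UPPER LAW** (open; the sharpness half — "every linear Hölder law pays `e^{-B}`",
generalising ROUND-15's funnel ceiling `linearHolderLaw_ceiling` from one family to a functional):
the ground exponent is at most `K (1 + size)^K e^{-B[q]}`.  Kit j276123: `γ e^{B} ≤ 5.1` over all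
255 profiles (`≤ 2.4` outside the funnel family). -/
@[conjecture]
def ArrheniusUpperLaw : Prop :=
  ∃ K : ℝ, 0 < K ∧ ∀ q : ℝ → ℝ, ContDiff ℝ 3 q → q 1 = 0 → q (-1) = 0 →
    (∃ γ : ℝ, IsPassiveExponent q γ) →
      ssGroundExponent q ≤ K * (1 + ssSize q) ^ K * Real.exp (-ssTrapDepth q)

/-- The funnel profile of ROUND-15/16 in the `q`-normalisation: `q_N(c) = (N/2) c (1-c²)`. -/
def funnelProfile (N : ℝ) (c : ℝ) : ℝ := N / 2 * c * (1 - c ^ 2)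

/-- KERNEL CHECK (funnel potential, = kit j276123 `B = N/4`): inside the interval the funnel's
meridional Péclet potential is the parabola `Φ(c) = (N/4) c²` — a symmetric well at the equator of
depth `N/4` toward either pole, the Arrhenius exponent of `γ ≈ √(N/π) e^{-N/4}`. -/
theorem ssPotential_funnel (N : ℝ) {c : ℝ} (hc : c ∈ Ioo (-1 : ℝ) 1) :
    ssPotential (funnelProfile N) c = N / 4 * c ^ 2 := by
  unfold ssPotential
  have heq : EqOn (fun x => funnelProfile N x / (1 - x ^ 2)) (fun x => N / 2 * x) (uIcc 0 c) := by
    intro x hx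
    have hx' : x ∈ Ioo (-1 : ℝ) 1 := by
      rcases le_total 0 c with h0c | hc0
      · rw [uIcc_of_le h0c] at hx
        exact ⟨by linarith [hx.1], lt_of_le_of_lt hx.2 hc.2⟩
      · rw [uIcc_of_ge hc0] at hx
        exact ⟨lt_of_lt_of_le hc.1 hx.1, by linarith [hx.2]⟩
    have hpos : 0 < 1 - x ^ 2 := by nlinarith [hx'.1, hx'.2]
    simp only [funnelProfile]
    field_simp
  rw [intervalIntegral.integral_congr heq, intervalIntegral.integral_const_mul, integral_id]
  ring

/-- KERNEL CHECK (Stokeslet stream, = kit j276123 `B = 0`): the potential of `q = a(1-c²)` is the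
LINEAR function `a·c` — monotone, no well: a one-way sweep traps nothing (`γ → 1⁺` as `a → ∞`). -/
theorem ssPotential_stokeslet (a : ℝ) {c : ℝ} (hc : c ∈ Ioo (-1 : ℝ) 1) :
    ssPotential (fun x => a * (1 - x ^ 2)) c = a * c := by
  unfold ssPotential
  have heq : EqOn (fun x => a * (1 - x ^ 2) / (1 - x ^ 2)) (fun _ => a) (uIcc 0 c) := by
    intro x hx
    have hx' : x ∈ Ioo (-1 : ℝ) 1 := by
      rcases le_total 0 c with h0c | hc0
      · rw [uIcc_of_le h0c] at hx
        exact ⟨by linarith [hx.1], lt_of_le_of_lt hx.2 hc.2⟩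
      · rw [uIcc_of_ge hc0] at hx
        exact ⟨lt_of_lt_of_le hc.1 hx.1, by linarith [hx.2]⟩
    have hpos : 0 < 1 - x ^ 2 := by nlinarith [hx'.1, hx'.2]
    simp only
    field_simp
  rw [intervalIntegral.integral_congr heq, intervalIntegral.integral_const]
  simp [mul_comm]

end

end Summit.NavierStokesRegularity.NavierStokesRegularity.Theorems.MeridionalBarrier
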